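import Summits.BirchSwinnertonDyer.Rank1Residual.Iwasawa.LambdaInvariantValuationLayer
import Literature.NumberTheory.LFunctions.DworkRationalityBorelDwork
import HarnessLib

/-!
# Route `AlignedTransportAtTwo`, crux C2 `MainConjectureOfRankZeroBSDAtTwo` (stmt-BirchSwinnertonDyer-22298):
# THE LAYER-VALUE BOUNDARY CERTIFICATE — for `G ∈ ℤ_p⟦T⟧ ∖ {0}` and `ζ` of order `pⁿ⁺¹` (`φ = φ(pⁿ⁺¹)`):
# `|G(ζ − 1)| = 1/p` and `|G(0)| ≠ 1/p` force `μ(G) = 0` AND `λ(G) = φ` — the BOUNDARY CASE `V = φ` of the tree's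
# one-value certificate (`Iwasawa/LambdaInvariantValuation{,Layer}`: `|G(ζ − 1)| > 1/p ⟹ μ = 0, λ < φ`; at `≤ 1/p` only
# «`μ ≥ 1 ∨ λ ≥ φ`», undetermined), for EVERY prime `p` and EVERY layer

HONEST FRAMING (cell `bsd-f1-sign2`, WIDTH-5 attached prover seat `bsd-line-att-p5` gen 50 on line `birth` of the lead
`bsd-line-att-p2`; `--supports` stmt-BirchSwinnertonDyer-22298, closes nothing; BSD is NOT proved by any of this; the crux C2, its
verdict «blocked-on `Rank1Residual.GreenbergMuConjectureIrreducible`» and every registered stub (P / T / Kμ / LimDoor / MuIneqʳ / PFμ⁺)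
are untouched). THEOREMS ONLY — pure `p`-adic Λ-algebra over the tree's valuation files; no `def`, no instance, no named fact, no
`sorry`; nothing about any curve is asserted in this file.

THE POINT. Write `G = p^μ · P · U` (`p`-content, Weierstrass preparation; `P` distinguished of degree `λ = λ(G)`, `U ∈ Λˣ`) and let
`z = ζ − 1`, `|z|^φ = 1/p`. The tree proves `|G(z)| = p^{−μ}|z|^λ` as long as `|z|^λ > 1/p` (`λ < φ`), whence the ONE-VALUE CERTIFICATE
`|G(z)| > 1/p ⟹ μ = 0 ∧ λ = φ·v_p(G(z))` and, at `|G(z)| ≤ 1/p`, only the alternative `μ ≥ 1 ∨ λ ≥ φ` (b2b ENGINE-T: «`V ≥ e_n`: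
undetermined»). This file decides the boundary value `|G(z)| = 1/p` (`V = φ`). Two elementary estimates do it:
(i) if `μ ≥ 1` and `|G(z)| ≥ 1/p` at ANY `|z| < 1`, then `λ = 0` and `μ = 1`, i.e. `G ∈ p·Λˣ`, so `|G(0)| = 1/p`
  (`lam_eq_zero_and_mu_eq_one_of_inv_le_norm_tsum`): hence **`|G(z)| ≥ 1/p ∧ |G(0)| ≠ 1/p ⟹ μ(G) = 0`** at any point of the open disc
  (`mu_eq_zero_of_inv_le_norm_tsum` — the CLOSED form of the certificate for `μ`);
(ii) for a distinguished `P` of degree `d ≥ 1` and `|z| ≤ 1`: **`|P(z) − P(0) − z^d| ≤ |z|/p`** (`norm_eval₂_sub_coeff_zero_sub_pow_le`), so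
  past the boundary (`|z|^d < 1/p`) `|P(z) − P(0)| < 1/p`, and AT the boundary (`|z|^d = 1/p`, `|P(0)| < 1/p`) `|P(z)| = 1/p` exactly.
Consequences (§3), for `G ≠ 0`, `ζ` of order `pⁿ⁺¹`:
* ★★★ `mu_eq_zero_and_lam_eq_totient_of_norm_tsum_eq_inv`: **`|G(ζ − 1)| = 1/p ∧ |G(0)| ≠ 1/p ⟹ μ(G) = 0 ∧ λ(G) = φ(pⁿ⁺¹)`**.
  The side condition is sharp: `G = p` (`μ = 1`, `λ = 0`) and `G = T^d + p` with `d > φ` (`μ = 0`, `λ = d`) both have `|G(ζ − 1)| = 1/p`.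
* ★★ converse `norm_tsum_eq_inv_of_lam_eq_totient` (`μ = 0`, `λ = φ`, `|G(0)| < 1/p ⟹ |G(ζ − 1)| = 1/p`) and the super-boundary readings
  `norm_tsum_lt_inv_of_totient_lt_lam` (`μ = 0`, `λ > φ`), `norm_tsum_lt_inv_of_one_le_mu` (`μ ≥ 1`).
The TRICHOTOMY under `p² ∣ G(0)` (`|G(ζ − 1)| >, =, < 1/p ⟺ (μ = 0, λ < φ), (μ = 0, λ = φ), (μ ≥ 1 ∨ λ > φ)`), the INTEGER form with the
extended range `V ≤ φ` and the ORBIT-PRODUCT (field-norm) form are in the sibling `…LayerValueTrichotomy`; the application to `X(W/ℚ_∞)`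
(crux C2's datum) and to Birch sums in `…LayerValueDoor` / `…LayerValueAnalytic`; memo `Cruxes/MainConjectureOfRankZeroBSDAtTwo/LAYER-VALUE-att-p5-g50.md`.
So the certificate's validity range extends from `V < φ(pⁿ⁺¹)` to `V ≤ φ(pⁿ⁺¹)` whenever `v_p(G(0)) ≠ 1` — at `p = 2` this decides each
`λ = 2ⁿ` ONE LAYER EARLIER.

References (ATTRIBUTION of the classical statements; proofs self-contained over the tree): L. Washington, GTM 83, §7.1–7.2 (Prop. 7.2,
Thm. 7.3) [Washington1997]; S. Lang, Cyclotomic Fields I–II, Ch. 5 §2 Thm. 2.2 [Lang1990]; R. Pollack, Duke Math. J. 118 (2003)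
Prop. 6.9–6.10 [Pollack2003]; tree `Iwasawa/LambdaInvariantValuation{,Layer,Twisted}.lean` (b2b-bsdres additive-p3 gen 10).
-/

set_option linter.dupNamespace false
set_option autoImplicit false

noncomputable section

open scoped Classical

namespace Summit.BirchSwinnertonDyer.BirchSwinnertonDyer.Theorems.AlignedTransportAtTwoLayerValueBoundary

open Polynomial Literature.NumberTheory.EllipticCurves
  Summit.BirchSwinnertonDyer.Rank1Residual.X1.MuLambda
  Summit.BirchSwinnertonDyer.Rank1Residual.Iwasawa

variable {p : ℕ} [hp : Fact p.Prime]

/-! ## §0 Evaluation at `z = 0` (the ultrametric «strongest wins» lemma is the tree's `Literature.NumberTheory.LFunctions.Dwork.norm_eq_of_norm_sub_lt'`) -/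

section Basic

/-- **Evaluation at `z = 0` is the constant coefficient**: `∑_k ι(a_k)·0^k = ι(a_0)`. [folklore] -/
theorem tsum_coeff_mul_zero_pow (A : IwasawaAlgebra p) :
    ∑' k, ((algebraMap ℚ_[p] ℂ_[p]).comp (algebraMap ℤ_[p] ℚ_[p])) (PowerSeries.coeff k A) * (0 : ℂ_[p]) ^ k =
      ((algebraMap ℚ_[p] ℂ_[p]).comp (algebraMap ℤ_[p] ℚ_[p])) (PowerSeries.constantCoeff A) := by
  rw [tsum_eq_single 0 (fun k hk ↦ by rw [zero_pow hk, mul_zero]), pow_zero, mul_one,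
    PowerSeries.coeff_zero_eq_constantCoeff_apply]

end Basic

/-! ## §1 Distinguished polynomials near the boundary `|z|^d = 1/p` -/

section Distinguished

/-- **`|P(z) − P(0) − z^d| ≤ |z|/p`** for a distinguished `P ∈ ℤ_p[X]` of degree `d ≥ 1` and `|z| ≤ 1` in `ℂ_p`: the middle terms
`a_i z^i` (`1 ≤ i < d`) have `a_i ∈ pℤ_p`, so `|a_i z^i| ≤ |z|/p`. [cite: Washington1997, §7.1 (distinguished polynomials) and Prop. 7.2] -/
theorem norm_eval₂_sub_coeff_zero_sub_pow_le {P : ℤ_[p][X]} (hP : P.IsDistinguishedAt (IsLocalRing.maximalIdeal ℤ_[p]))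
    (hd : 1 ≤ P.natDegree) {z : ℂ_[p]} (hz : ‖z‖ ≤ 1) :
    ‖P.eval₂ ((algebraMap ℚ_[p] ℂ_[p]).comp (algebraMap ℤ_[p] ℚ_[p])) z -
        ((algebraMap ℚ_[p] ℂ_[p]).comp (algebraMap ℤ_[p] ℚ_[p])) (P.coeff 0) - z ^ P.natDegree‖ ≤ (p : ℝ)⁻¹ * ‖z‖ := by
  set ιZ : ℤ_[p] →+* ℂ_[p] := (algebraMap ℚ_[p] ℂ_[p]).comp (algebraMap ℤ_[p] ℚ_[p]) with hιZ
  obtain ⟨d, hd'⟩ : ∃ d, P.natDegree = d + 1 := ⟨P.natDegree - 1, by omega⟩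
  have hmonic : P.Monic := hP.monic
  -- `P(z) = (Σ_{i<d} ι(a_{i+1}) z^{i+1} + ι(a_0)·z^0) + z^{d+1}`
  have hsplit : P.eval₂ ιZ z =
      ((∑ i ∈ Finset.range d, ιZ (P.coeff (i + 1)) * z ^ (i + 1)) + ιZ (P.coeff 0) * z ^ 0) + z ^ (d + 1) := by
    rw [eval₂_eq_sum_range, hd', Finset.sum_range_succ, Finset.sum_range_succ']
    congr 1
    rw [show P.coeff (d + 1) = 1 from by rw [← hd']; exact hmonic.coeff_natDegree, map_one, one_mul]
  have hq : 0 ≤ (p : ℝ)⁻¹ := inv_nonneg.mpr (Nat.cast_nonneg _)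
  have hterm : ∀ i ∈ Finset.range d, ‖ιZ (P.coeff (i + 1)) * z ^ (i + 1)‖ ≤ (p : ℝ)⁻¹ * ‖z‖ := by
    intro i hi
    rw [Finset.mem_range] at hi
    have hmem : P.coeff (i + 1) ∈ IsLocalRing.maximalIdeal ℤ_[p] := hP.mem (by omega)
    rw [norm_mul, norm_pow]
    refine mul_le_mul (norm_algebraMap_comp_le_inv_of_mem_maximalIdeal hmem) ?_ (pow_nonneg (norm_nonneg _) _) hq
    calc ‖z‖ ^ (i + 1) ≤ ‖z‖ ^ 1 := pow_le_pow_of_le_one (norm_nonneg _) hz (by omega)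
      _ = ‖z‖ := pow_one _
  have hsum : ‖∑ i ∈ Finset.range d, ιZ (P.coeff (i + 1)) * z ^ (i + 1)‖ ≤ (p : ℝ)⁻¹ * ‖z‖ :=
    IsUltrametricDist.norm_sum_le_of_forall_le_of_nonneg (mul_nonneg hq (norm_nonneg _)) hterm
  have heq : P.eval₂ ιZ z - ιZ (P.coeff 0) - z ^ P.natDegree =
      ∑ i ∈ Finset.range d, ιZ (P.coeff (i + 1)) * z ^ (i + 1) := by
    rw [hsplit, hd', pow_zero, mul_one]; ring
  rw [heq]
  exact hsum

/-- **Past the boundary**: for a distinguished `P` of degree `d ≥ 1`, `|z| < 1` and `|z|^d < 1/p`: `|P(z) − P(0)| < 1/p`.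
[cite: Washington1997, §7.1 (distinguished polynomials) and Prop. 7.2] -/
theorem norm_eval₂_sub_coeff_zero_lt {P : ℤ_[p][X]} (hP : P.IsDistinguishedAt (IsLocalRing.maximalIdeal ℤ_[p]))
    (hd : 1 ≤ P.natDegree) {z : ℂ_[p]} (hz : ‖z‖ < 1) (hzd : ‖z‖ ^ P.natDegree < (p : ℝ)⁻¹) :
    ‖P.eval₂ ((algebraMap ℚ_[p] ℂ_[p]).comp (algebraMap ℤ_[p] ℚ_[p])) z -
        ((algebraMap ℚ_[p] ℂ_[p]).comp (algebraMap ℤ_[p] ℚ_[p])) (P.coeff 0)‖ < (p : ℝ)⁻¹ := by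
  set ιZ : ℤ_[p] →+* ℂ_[p] := (algebraMap ℚ_[p] ℂ_[p]).comp (algebraMap ℤ_[p] ℚ_[p]) with hιZ
  have h1 := norm_eval₂_sub_coeff_zero_sub_pow_le hP hd hz.le
  have hq0 : 0 < (p : ℝ)⁻¹ := (inv_prime_pos_and_lt_one (p := p)).1
  have h2 : (p : ℝ)⁻¹ * ‖z‖ < (p : ℝ)⁻¹ := by
    calc (p : ℝ)⁻¹ * ‖z‖ < (p : ℝ)⁻¹ * 1 := mul_lt_mul_of_pos_left hz hq0
      _ = (p : ℝ)⁻¹ := mul_one _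
  calc ‖P.eval₂ ιZ z - ιZ (P.coeff 0)‖
      = ‖(P.eval₂ ιZ z - ιZ (P.coeff 0) - z ^ P.natDegree) + z ^ P.natDegree‖ := by rw [sub_add_cancel]
    _ ≤ max ‖P.eval₂ ιZ z - ιZ (P.coeff 0) - z ^ P.natDegree‖ ‖z ^ P.natDegree‖ :=
        IsUltrametricDist.norm_add_le_max _ _
    _ < (p : ℝ)⁻¹ := max_lt (lt_of_le_of_lt h1 h2) (by rwa [norm_pow])

/-- **At the boundary**: for a distinguished `P` of degree `d ≥ 1`, `|z| < 1`, `|z|^d = 1/p` and `|P(0)| < 1/p`: `|P(z)| = 1/p`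
(the leading power dominates strictly). [cite: Washington1997, §7.1 (distinguished polynomials) and Prop. 7.2] -/
theorem norm_eval₂_eq_inv_of_norm_pow_eq {P : ℤ_[p][X]} (hP : P.IsDistinguishedAt (IsLocalRing.maximalIdeal ℤ_[p]))
    (hd : 1 ≤ P.natDegree) {z : ℂ_[p]} (hz : ‖z‖ < 1) (hzd : ‖z‖ ^ P.natDegree = (p : ℝ)⁻¹)
    (h0 : ‖((algebraMap ℚ_[p] ℂ_[p]).comp (algebraMap ℤ_[p] ℚ_[p])) (P.coeff 0)‖ < (p : ℝ)⁻¹) :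
    ‖P.eval₂ ((algebraMap ℚ_[p] ℂ_[p]).comp (algebraMap ℤ_[p] ℚ_[p])) z‖ = (p : ℝ)⁻¹ := by
  set ιZ : ℤ_[p] →+* ℂ_[p] := (algebraMap ℚ_[p] ℂ_[p]).comp (algebraMap ℤ_[p] ℚ_[p]) with hιZ
  have h1 := norm_eval₂_sub_coeff_zero_sub_pow_le hP hd hz.le
  have hq0 : 0 < (p : ℝ)⁻¹ := (inv_prime_pos_and_lt_one (p := p)).1
  have h2 : (p : ℝ)⁻¹ * ‖z‖ < (p : ℝ)⁻¹ := by
    calc (p : ℝ)⁻¹ * ‖z‖ < (p : ℝ)⁻¹ * 1 := mul_lt_mul_of_pos_left hz hq0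
      _ = (p : ℝ)⁻¹ := mul_one _
  have hsmall : ‖(P.eval₂ ιZ z - ιZ (P.coeff 0) - z ^ P.natDegree) + ιZ (P.coeff 0)‖ < (p : ℝ)⁻¹ :=
    lt_of_le_of_lt (IsUltrametricDist.norm_add_le_max _ _) (max_lt (lt_of_le_of_lt h1 h2) h0)
  have heq : P.eval₂ ιZ z = ((P.eval₂ ιZ z - ιZ (P.coeff 0) - z ^ P.natDegree) + ιZ (P.coeff 0)) + z ^ P.natDegree := by
    ring
  have hne : ‖(P.eval₂ ιZ z - ιZ (P.coeff 0) - z ^ P.natDegree) + ιZ (P.coeff 0)‖ ≠ ‖z ^ P.natDegree‖ := by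
    rw [norm_pow, hzd]; exact hsmall.ne
  rw [heq, IsUltrametricDist.norm_add_eq_max_of_norm_ne_norm hne, norm_pow, hzd]
  exact max_eq_right hsmall.le

end Distinguished

/-! ## §2 The constant term through the Weierstrass factorisation; the closed certificate for `μ` -/

section Closed

/-- **`|G(0)| = p^{−μ(G)}·|P(0)|`** for `G = p^m·G'`, `G' ≢ 0 (mod p)`, `P` the distinguished polynomial of `G'` (the tree's
`norm_tsum_eq_mul_norm_eval₂` at `z = 0`). [cite: Washington1997, §7.1–7.2 and Thm. 7.3] -/
theorem norm_constantCoeff_eq_mul_norm_coeff_zero {G G' : IwasawaAlgebra p} {m : ℕ}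
    (hGG' : G = PowerSeries.C ((p : ℤ_[p]) ^ m) * G') (hG' : G'.map (IsLocalRing.residue ℤ_[p]) ≠ 0) :
    ‖((algebraMap ℚ_[p] ℂ_[p]).comp (algebraMap ℤ_[p] ℚ_[p])) (PowerSeries.constantCoeff G)‖ =
      ((p : ℝ)⁻¹) ^ mu G *
        ‖((algebraMap ℚ_[p] ℂ_[p]).comp (algebraMap ℤ_[p] ℚ_[p])) ((G'.weierstrassDistinguished hG').coeff 0)‖ := by
  have h := norm_tsum_eq_mul_norm_eval₂ hGG' hG' (z := (0 : ℂ_[p])) (by rw [norm_zero]; exact zero_lt_one)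
  rwa [tsum_coeff_mul_zero_pow, eval₂_at_zero] at h

/-- **`μ ≥ 1` and `|G(z)| ≥ 1/p` at ONE point `|z| < 1` force `G ∈ p·Λˣ`**: `λ(G) = 0`, `μ(G) = 1` and `|G(0)| = 1/p` (if `λ ≥ 1` then
`|G(z)| ≤ p^{−μ}·max(|z|^λ, 1/p) < p^{−μ} ≤ 1/p`; so `G = p^μ·U`, `|G(z)| = p^{−μ} = 1/p`). [cite: Washington1997, §7.1–7.2 and Thm. 7.3] -/
theorem lam_eq_zero_and_mu_eq_one_of_inv_le_norm_tsum {G : IwasawaAlgebra p} (hG0 : G ≠ 0) {z : ℂ_[p]} (hz : ‖z‖ < 1)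
    (h : (p : ℝ)⁻¹ ≤ ‖∑' k, ((algebraMap ℚ_[p] ℂ_[p]).comp (algebraMap ℤ_[p] ℚ_[p])) (PowerSeries.coeff k G) * z ^ k‖)
    (hμ : 1 ≤ mu G) :
    lam G = 0 ∧ mu G = 1 ∧
      ‖((algebraMap ℚ_[p] ℂ_[p]).comp (algebraMap ℤ_[p] ℚ_[p])) (PowerSeries.constantCoeff G)‖ = (p : ℝ)⁻¹ := by
  obtain ⟨hq0, hq1⟩ := inv_prime_pos_and_lt_one (p := p)
  have hle := norm_tsum_le_of_ne_zero hG0 hz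
  have hpowμ : ((p : ℝ)⁻¹) ^ mu G ≤ (p : ℝ)⁻¹ := by
    calc ((p : ℝ)⁻¹) ^ mu G ≤ ((p : ℝ)⁻¹) ^ 1 := pow_le_pow_of_le_one hq0.le hq1.le hμ
      _ = (p : ℝ)⁻¹ := pow_one _
  -- `λ(G) = 0`
  have hlam : lam G = 0 := by
    by_contra hne
    have hzl : ‖z‖ ^ lam G < 1 := pow_lt_one₀ (norm_nonneg _) hz hne
    have hmax : max (‖z‖ ^ lam G) ((p : ℝ)⁻¹) < 1 := max_lt hzl hq1
    have hlt : ((p : ℝ)⁻¹) ^ mu G * max (‖z‖ ^ lam G) ((p : ℝ)⁻¹) < (p : ℝ)⁻¹ := by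
      calc ((p : ℝ)⁻¹) ^ mu G * max (‖z‖ ^ lam G) ((p : ℝ)⁻¹) < ((p : ℝ)⁻¹) ^ mu G * 1 :=
            mul_lt_mul_of_pos_left hmax (pow_pos hq0 _)
        _ ≤ (p : ℝ)⁻¹ := by rw [mul_one]; exact hpowμ
    exact absurd (lt_of_le_of_lt (le_trans h hle) hlt) (lt_irrefl _)
  -- `|G(z)| = p^{−μ}`, so `μ = 1`
  have heq := norm_tsum_eq_of_lt_norm_pow_lam hG0 hz (by rw [hlam, pow_zero]; exact hq1)
  rw [hlam, pow_zero, mul_one] at heq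
  have hμ1 : mu G = 1 := by
    refine le_antisymm ?_ hμ
    by_contra hlt
    rw [not_le] at hlt
    have hlt' : ((p : ℝ)⁻¹) ^ mu G < (p : ℝ)⁻¹ := by
      calc ((p : ℝ)⁻¹) ^ mu G ≤ ((p : ℝ)⁻¹) ^ 2 := pow_le_pow_of_le_one hq0.le hq1.le hlt
        _ < ((p : ℝ)⁻¹) ^ 1 := pow_lt_pow_right_of_lt_one₀ hq0 hq1 (by norm_num)
        _ = (p : ℝ)⁻¹ := pow_one _
    rw [← heq] at hlt'
    exact absurd (lt_of_le_of_lt h hlt') (lt_irrefl _)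
  refine ⟨hlam, hμ1, ?_⟩
  -- at `z = 0`: `|G(0)| = p^{−μ}·|0|^0 = 1/p`
  have h0 := norm_tsum_eq_of_lt_norm_pow_lam hG0 (z := (0 : ℂ_[p])) (by rw [norm_zero]; exact zero_lt_one)
    (by rw [hlam, pow_zero]; exact hq1)
  rw [tsum_coeff_mul_zero_pow, hlam, pow_zero, mul_one, hμ1, pow_one] at h0
  exact h0

/-- ★★ **THE CLOSED ONE-VALUE CERTIFICATE FOR `μ`.** For `G ∈ Λ ∖ {0}` and ANY `|z| < 1`: **`|G(z)| ≥ 1/p` and `|G(0)| ≠ 1/p` ⟹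
`μ(G) = 0`** (the tree's certificate needs `|G(z)| > 1/p`; the closed inequality costs only the exclusion of `G ∈ p·Λˣ`).
[cite: Washington1997, §7.1–7.2 and Thm. 7.3] -/
theorem mu_eq_zero_of_inv_le_norm_tsum {G : IwasawaAlgebra p} (hG0 : G ≠ 0) {z : ℂ_[p]} (hz : ‖z‖ < 1)
    (h : (p : ℝ)⁻¹ ≤ ‖∑' k, ((algebraMap ℚ_[p] ℂ_[p]).comp (algebraMap ℤ_[p] ℚ_[p])) (PowerSeries.coeff k G) * z ^ k‖)
    (h0 : ‖((algebraMap ℚ_[p] ℂ_[p]).comp (algebraMap ℤ_[p] ℚ_[p])) (PowerSeries.constantCoeff G)‖ ≠ (p : ℝ)⁻¹) :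
    mu G = 0 := by
  by_contra hne
  exact h0 (lam_eq_zero_and_mu_eq_one_of_inv_le_norm_tsum hG0 hz h (Nat.one_le_iff_ne_zero.mpr hne)).2.2

/-- The same as a dichotomy without side condition: `|G(z)| ≥ 1/p` ⟹ `μ(G) = 0`, or `G ∈ p·Λˣ` (`μ(G) = 1 ∧ λ(G) = 0`).
[cite: Washington1997, §7.1–7.2 and Thm. 7.3] -/
theorem mu_eq_zero_or_of_inv_le_norm_tsum {G : IwasawaAlgebra p} (hG0 : G ≠ 0) {z : ℂ_[p]} (hz : ‖z‖ < 1)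
    (h : (p : ℝ)⁻¹ ≤ ‖∑' k, ((algebraMap ℚ_[p] ℂ_[p]).comp (algebraMap ℤ_[p] ℚ_[p])) (PowerSeries.coeff k G) * z ^ k‖) :
    mu G = 0 ∨ (mu G = 1 ∧ lam G = 0) := by
  by_cases hμ : mu G = 0
  · exact Or.inl hμ
  · obtain ⟨hlam, hμ1, -⟩ :=
      lam_eq_zero_and_mu_eq_one_of_inv_le_norm_tsum hG0 hz h (Nat.one_le_iff_ne_zero.mpr hμ)
    exact Or.inr ⟨hμ1, hlam⟩

/-- **`μ ≥ 1` (and `G ∉ p·Λˣ`, read off `|G(0)| ≠ 1/p`) forces `|G(z)| < 1/p` at every `|z| < 1`.** [cite: Washington1997, §7.1–7.2 and Thm. 7.3] -/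
theorem norm_tsum_lt_inv_of_one_le_mu {G : IwasawaAlgebra p} (hG0 : G ≠ 0) {z : ℂ_[p]} (hz : ‖z‖ < 1) (hμ : 1 ≤ mu G)
    (h0 : ‖((algebraMap ℚ_[p] ℂ_[p]).comp (algebraMap ℤ_[p] ℚ_[p])) (PowerSeries.constantCoeff G)‖ ≠ (p : ℝ)⁻¹) :
    ‖∑' k, ((algebraMap ℚ_[p] ℂ_[p]).comp (algebraMap ℤ_[p] ℚ_[p])) (PowerSeries.coeff k G) * z ^ k‖ < (p : ℝ)⁻¹ := by
  by_contra hle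
  rw [not_lt] at hle
  have hμ0 := mu_eq_zero_of_inv_le_norm_tsum hG0 hz hle h0
  omega

end Closed

/-! ## §3 At a layer: the boundary value `|G(ζ − 1)| = 1/p` decides `μ = 0` AND `λ = φ(pⁿ⁺¹)` -/

section Layer

/-- ★★★ **THE LAYER-VALUE BOUNDARY CERTIFICATE.** For `G ∈ Λ ∖ {0}` and `ζ ∈ ℂ_p` of order `pⁿ⁺¹`: if **`|G(ζ − 1)| = 1/p`** and
**`|G(0)| ≠ 1/p`**, then **`μ(G) = 0` and `λ(G) = φ(pⁿ⁺¹)`**. (`μ = 0` by the closed certificate; `λ ≥ φ` by the tree's undetermined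
regime; if `λ > φ` then `|ζ − 1|^λ < 1/p`, so `|P(ζ − 1) − P(0)| < 1/p = |P(ζ − 1)|` forces `|G(0)| = |P(0)| = 1/p`.) The boundary row
`V = φ(pⁿ⁺¹)` of the b2b ENGINE-T validity rule, decided. [cite: Washington1997, §7.1–7.2 and Thm. 7.3] [cite: Pollack2003, Prop. 6.9–6.10] -/
theorem mu_eq_zero_and_lam_eq_totient_of_norm_tsum_eq_inv {G : IwasawaAlgebra p} (hG0 : G ≠ 0) {n : ℕ} {ζ : ℂ_[p]}
    (hζ : IsPrimitiveRoot ζ (p ^ (n + 1)))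
    (h : ‖∑' k, ((algebraMap ℚ_[p] ℂ_[p]).comp (algebraMap ℤ_[p] ℚ_[p])) (PowerSeries.coeff k G) * (ζ - 1) ^ k‖ = (p : ℝ)⁻¹)
    (h0 : ‖((algebraMap ℚ_[p] ℂ_[p]).comp (algebraMap ℤ_[p] ℚ_[p])) (PowerSeries.constantCoeff G)‖ ≠ (p : ℝ)⁻¹) :
    mu G = 0 ∧ lam G = Nat.totient (p ^ (n + 1)) := by
  set ιZ : ℤ_[p] →+* ℂ_[p] := (algebraMap ℚ_[p] ℂ_[p]).comp (algebraMap ℤ_[p] ℚ_[p]) with hιZ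
  obtain ⟨hz0, hz⟩ := norm_sub_one_pos_and_lt_one hζ
  have hμ : mu G = 0 := mu_eq_zero_of_inv_le_norm_tsum hG0 hz h.ge h0
  have hφle : Nat.totient (p ^ (n + 1)) ≤ lam G := by
    rcases (norm_tsum_le_iff_one_le_mu_or_totient_le_lam hG0 hζ).mp h.le with h1 | h2
    · omega
    · exact h2
  refine ⟨hμ, le_antisymm ?_ hφle⟩
  by_contra hlt
  rw [not_le] at hlt
  -- Weierstrass factorisation `G = p^m·P·U`, `m = μ = 0`
  obtain ⟨m, G', hGG', hG'⟩ := IwasawaAlgebra.exists_eq_C_pow_mul_and_map_residue_ne_zero p hG0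
  set P : ℤ_[p][X] := G'.weierstrassDistinguished hG' with hP
  have hPd : P.IsDistinguishedAt (IsLocalRing.maximalIdeal ℤ_[p]) := G'.isDistinguishedAt_weierstrassDistinguished hG'
  have hlamP : lam G = P.natDegree := lam_eq_natDegree_weierstrassDistinguished hGG' hG'
  have hnormG := norm_tsum_eq_mul_norm_eval₂ hGG' hG' hz
  rw [hμ, pow_zero, one_mul] at hnormG
  have hG0norm := norm_constantCoeff_eq_mul_norm_coeff_zero hGG' hG'
  rw [hμ, pow_zero, one_mul] at hG0norm
  -- `|ζ − 1|^{deg P} < 1/p`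
  have hzd : ‖ζ - 1‖ ^ P.natDegree < (p : ℝ)⁻¹ := by
    rw [← hlamP]
    calc ‖ζ - 1‖ ^ lam G ≤ ‖ζ - 1‖ ^ (Nat.totient (p ^ (n + 1)) + 1) := pow_le_pow_of_le_one (norm_nonneg _) hz.le hlt
      _ = ‖ζ - 1‖ ^ Nat.totient (p ^ (n + 1)) * ‖ζ - 1‖ := pow_succ _ _
      _ < ‖ζ - 1‖ ^ Nat.totient (p ^ (n + 1)) * 1 := mul_lt_mul_of_pos_left hz (pow_pos hz0 _)
      _ = (p : ℝ)⁻¹ := by rw [mul_one, norm_sub_one_pow_totient_eq hζ]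
  have hd1 : 1 ≤ P.natDegree := by
    rw [← hlamP]
    exact le_trans (Nat.totient_pos.mpr (pow_pos hp.out.pos _)) hφle
  have hsmall := norm_eval₂_sub_coeff_zero_lt hPd hd1 hz hzd
  have hPz : ‖P.eval₂ ιZ (ζ - 1)‖ = (p : ℝ)⁻¹ := by rw [← hnormG]; exact h
  have hlt' : ‖P.eval₂ ιZ (ζ - 1) - ιZ (P.coeff 0)‖ < ‖P.eval₂ ιZ (ζ - 1)‖ := by rw [hPz]; exact hsmall
  have hP0 : ‖ιZ (P.coeff 0)‖ = (p : ℝ)⁻¹ := by rw [Literature.NumberTheory.LFunctions.Dwork.norm_eq_of_norm_sub_lt' hlt', hPz]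
  exact h0 (hG0norm.trans hP0)

/-- ★★ **EXACTNESS (converse)**: `μ(G) = 0`, `λ(G) = φ(pⁿ⁺¹)` and `|G(0)| < 1/p` ⟹ `|G(ζ − 1)| = 1/p` (the leading power `z^φ`,
`|z^φ| = 1/p`, strictly dominates `P(0)` and the middle terms). [cite: Washington1997, §7.1–7.2 and Thm. 7.3] -/
theorem norm_tsum_eq_inv_of_lam_eq_totient {G : IwasawaAlgebra p} (hG0 : G ≠ 0) (hμ : mu G = 0) {n : ℕ} {ζ : ℂ_[p]}
    (hζ : IsPrimitiveRoot ζ (p ^ (n + 1))) (hlam : lam G = Nat.totient (p ^ (n + 1)))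
    (h0 : ‖((algebraMap ℚ_[p] ℂ_[p]).comp (algebraMap ℤ_[p] ℚ_[p])) (PowerSeries.constantCoeff G)‖ < (p : ℝ)⁻¹) :
    ‖∑' k, ((algebraMap ℚ_[p] ℂ_[p]).comp (algebraMap ℤ_[p] ℚ_[p])) (PowerSeries.coeff k G) * (ζ - 1) ^ k‖ = (p : ℝ)⁻¹ := by
  obtain ⟨-, hz⟩ := norm_sub_one_pos_and_lt_one hζ
  obtain ⟨m, G', hGG', hG'⟩ := IwasawaAlgebra.exists_eq_C_pow_mul_and_map_residue_ne_zero p hG0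
  set P : ℤ_[p][X] := G'.weierstrassDistinguished hG' with hP
  have hPd : P.IsDistinguishedAt (IsLocalRing.maximalIdeal ℤ_[p]) := G'.isDistinguishedAt_weierstrassDistinguished hG'
  have hlamP : lam G = P.natDegree := lam_eq_natDegree_weierstrassDistinguished hGG' hG'
  have hnormG := norm_tsum_eq_mul_norm_eval₂ hGG' hG' hz
  rw [hμ, pow_zero, one_mul] at hnormG
  have hG0norm := norm_constantCoeff_eq_mul_norm_coeff_zero hGG' hG'
  rw [hμ, pow_zero, one_mul] at hG0norm
  have hd1 : 1 ≤ P.natDegree := by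
    rw [← hlamP, hlam]; exact Nat.totient_pos.mpr (pow_pos hp.out.pos _)
  have hzd : ‖ζ - 1‖ ^ P.natDegree = (p : ℝ)⁻¹ := by rw [← hlamP, hlam, norm_sub_one_pow_totient_eq hζ]
  rw [hnormG]
  exact norm_eval₂_eq_inv_of_norm_pow_eq hPd hd1 hz hzd (by rw [← hG0norm]; exact h0)

/-- ★★ **PAST THE BOUNDARY**: `μ(G) = 0`, `λ(G) > φ(pⁿ⁺¹)` and `|G(0)| < 1/p` ⟹ `|G(ζ − 1)| < 1/p`. [cite: Washington1997, §7.1–7.2 and Thm. 7.3] -/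
theorem norm_tsum_lt_inv_of_totient_lt_lam {G : IwasawaAlgebra p} (hG0 : G ≠ 0) (hμ : mu G = 0) {n : ℕ} {ζ : ℂ_[p]}
    (hζ : IsPrimitiveRoot ζ (p ^ (n + 1))) (hlam : Nat.totient (p ^ (n + 1)) < lam G)
    (h0 : ‖((algebraMap ℚ_[p] ℂ_[p]).comp (algebraMap ℤ_[p] ℚ_[p])) (PowerSeries.constantCoeff G)‖ < (p : ℝ)⁻¹) :
    ‖∑' k, ((algebraMap ℚ_[p] ℂ_[p]).comp (algebraMap ℤ_[p] ℚ_[p])) (PowerSeries.coeff k G) * (ζ - 1) ^ k‖ < (p : ℝ)⁻¹ := by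
  set ιZ : ℤ_[p] →+* ℂ_[p] := (algebraMap ℚ_[p] ℂ_[p]).comp (algebraMap ℤ_[p] ℚ_[p]) with hιZ
  obtain ⟨hz0, hz⟩ := norm_sub_one_pos_and_lt_one hζ
  obtain ⟨m, G', hGG', hG'⟩ := IwasawaAlgebra.exists_eq_C_pow_mul_and_map_residue_ne_zero p hG0
  set P : ℤ_[p][X] := G'.weierstrassDistinguished hG' with hP
  have hPd : P.IsDistinguishedAt (IsLocalRing.maximalIdeal ℤ_[p]) := G'.isDistinguishedAt_weierstrassDistinguished hG'
  have hlamP : lam G = P.natDegree := lam_eq_natDegree_weierstrassDistinguished hGG' hG'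
  have hnormG := norm_tsum_eq_mul_norm_eval₂ hGG' hG' hz
  rw [hμ, pow_zero, one_mul] at hnormG
  have hG0norm := norm_constantCoeff_eq_mul_norm_coeff_zero hGG' hG'
  rw [hμ, pow_zero, one_mul] at hG0norm
  have hzd : ‖ζ - 1‖ ^ P.natDegree < (p : ℝ)⁻¹ := by
    rw [← hlamP]
    calc ‖ζ - 1‖ ^ lam G ≤ ‖ζ - 1‖ ^ (Nat.totient (p ^ (n + 1)) + 1) := pow_le_pow_of_le_one (norm_nonneg _) hz.le hlam
      _ = ‖ζ - 1‖ ^ Nat.totient (p ^ (n + 1)) * ‖ζ - 1‖ := pow_succ _ _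
      _ < ‖ζ - 1‖ ^ Nat.totient (p ^ (n + 1)) * 1 := mul_lt_mul_of_pos_left hz (pow_pos hz0 _)
      _ = (p : ℝ)⁻¹ := by rw [mul_one, norm_sub_one_pow_totient_eq hζ]
  have hd1 : 1 ≤ P.natDegree := by
    rw [← hlamP]
    exact le_trans (Nat.totient_pos.mpr (pow_pos hp.out.pos _)) hlam.le
  have hsmall := norm_eval₂_sub_coeff_zero_lt hPd hd1 hz hzd
  rw [hnormG]
  calc ‖P.eval₂ ιZ (ζ - 1)‖ = ‖(P.eval₂ ιZ (ζ - 1) - ιZ (P.coeff 0)) + ιZ (P.coeff 0)‖ := by rw [sub_add_cancel]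
    _ ≤ max ‖P.eval₂ ιZ (ζ - 1) - ιZ (P.coeff 0)‖ ‖ιZ (P.coeff 0)‖ := IsUltrametricDist.norm_add_le_max _ _
    _ < (p : ℝ)⁻¹ := max_lt hsmall (by rw [← hG0norm]; exact h0)

end Layer

end Summit.BirchSwinnertonDyer.BirchSwinnertonDyer.Theorems.AlignedTransportAtTwoLayerValueBoundary

end
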